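import Literature.Computability.AlgebraicComplexity.LMR13DualVarieties
import Literature.Computability.AlgebraicComplexity.LMRDetIdealModuleWeight
import Literature.Computability.AlgebraicComplexity.HessianRank
import Literature.Computability.AlgebraicComplexity.LinSubst
import Mathlib.LinearAlgebra.FiniteDimensional.Lemmas
import HarnessLib

/-!
# LMR 2013, Prop. 4.1.1 as printed is FALSE: along `Sub_{k+2}` the Zariski tangent space of
# `𝒟ual_{k,d,N}` exceeds the tangent space of `Sub_{k+2}` at EVERY point (`(k,d,N) = (0,3,3)`)

Cell val-lit (D-0074), row LMR13-A, lead-lmr g3 RULING/FINDING 2026-08-26T12:01:08Z (erratum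
candidate; GO to this seat for the refutation through conjunct (ii)). Companion of
`LMR13DualVarieties.lean`, where Landsberg–Manivel–Ressayre 2013, Prop. 4.1.1 (Comment. Math. Helv.
88, p. 482 = arXiv 1004.4802 Prop. 4.0.3: "`Sub_{k+2}(S^d ℂ^N)` is a reduced, irreducible component
of `𝒟ual_{k,d,N}`") is the named fact `LMR2013_prop_4_1_1`, typed VERBATIM with "reduced" rendered
as the statement the printed proof claims to establish: the Zariski tangent space of `𝒟ual_{k,d,N}`
at a general point `P = Q(L)` of `Sub_{k+2}` lies in `T̂_P Sub_{k+2}` (`subspaceTangent`).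

## Result

`not_LMR2013_prop_4_1_1 : ¬ LMR2013_prop_4_1_1 (σ := Fin 3)` — **the named fact is REFUTED**
(at `k = 0`, `d = 3`, `N = 3`). The typed text is FAITHFUL to the print; this is an ERRATUM for the
source, not a typing defect. Its PROVED parts remain: `subspaceVariety_subset_lmrDualScheme` (⊆),
closedness (`LMR13SubspaceVarietyClosed.lean`), `subspaceVariety_isCoeffZariskiIrreducible`.
(The first conjunct, "component", is refuted independently at `k = 0` by
`Sub₂(S³ℂ³) ⊊ Δ(xyz) ⊆ 𝒟_{0,3,3}` — a separate file of the cell.)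

## Proof

(A) `linSubst_X_mul_rename_mem_lmrZariskiTangent`: for EVERY `3 × 3` matrix `A`, binary cubic `Q`
and binary quadric `q̂`, the "transverse" form `π = A·(z·q̂(x,y))` is a Zariski tangent vector of
`𝒟ual_{0,3,3}` at `P₀ = A·Q(x,y)`: over `ℂ[ε]`, `P₀ + επ = A·(Q(x,y) + ε z q̂(x,y))`
(`firstOrderDeformation_linSubst`); the Hessian of `Q(x,y) + ε z q̂(x,y)` has last row and column
divisible by `ε` and `(z,z)`-entry `0`, so its determinant is `≡ 0 (mod ε²)`
(`det_hessPoly_firstOrderDeformation_coordinate`, `Matrix.det_fin_three`); at `k + 3 = N` the frame is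
square and `hessGenMinor (BA)(BA) f = det(BA)² · det Hess f` (`hessGenMinor_square`), transported by
`A` (`hessGenMinor_linSubst`); eq. (2) is linear in the Hessian minor (`binCoeff_C_mul`,
`lmrRemainder_mul_right`), hence `[ε¹] E_{B,u,v}(P₀ + επ) = 0` for ALL `(B, u, v)`.
(B) `exists_quadric_not_mem_subspaceTangent`: if `A·(z q̂(x,y)) ∈ T̂Sub` (presented by `L_j = A·x_j`,
`A` with a left inverse) then pulling back by `A⁻¹` and differentiating in `z` gives
`q̂ ∈ span{∂₀Q, ∂₁Q}` (`mem_span_pderiv_of_mem_subspaceTangent`), a space of dimension `≤ 2`; the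
three monomials `x², xy, y²` are independent, so one of them is excluded.
(C) `exists_linSubst_rename_of_mem_subspaceVariety`: every point of `Sub₂(S³ℂ³)` is `A·Q(x,y)` with
`A ∈ GL₃` (a permutation moves the surviving variables onto `x, y`); so the `g`-general point
supplied by the fact itself is of this form, and (A) + (B) contradict the asserted inclusion.

The printed proof (arXiv p0010:L52–L81) bounds the transverse part `S^{d−1}U* ⊗ V*` by the
ORDER-`ε²` term — which constrains 2-jets, not the Zariski tangent space; the scheme cut out by the
equations (2) is not generically reduced along `Sub_{k+2}`.

Theorems only (+ private plumbing `quadMono`, `quadExpo`); no named facts. Honest framing: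
literature hygiene (an erratum for a component/reducedness lemma of the GCT boundary programme); it
proves nothing about `dc(per)`, and VP ≠ VNP is NOT proved — nothing here is progress on it.

## References

* J. M. Landsberg, L. Manivel, N. Ressayre, *Hypersurfaces with degenerate duals and the geometric
  complexity theory program*, Comment. Math. Helv. 88 (2013) 469–484, Prop. 4.1.1 (p. 482) and its
  proof; arXiv:1004.4802 Prop. 4.0.3, p0010:L18–L81.
  [cite: LandsbergManivelRessayre2013, Proposition 4.1.1 (p. 482)]
-/
noncomputable section

open MvPolynomial Matrix

namespace Literature.Computability.AlgebraicComplexity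

open _root_.Literature.NumberTheory.DiophantineGeometry

/-! ### Base change of a linear substitution -/

section BaseChange

variable {σ : Type*} [Fintype σ]

/-- The first-order deformation of substituted data is the substituted deformation (over `ℂ[ε]`).
[cite: LandsbergManivelRessayre2013, §3.3 (p. 477)] -/
theorem firstOrderDeformation_linSubst (A : Matrix σ σ ℂ) (P π : MvPolynomial σ ℂ) :
    firstOrderDeformation (linSubst σ ℂ A P) (linSubst σ ℂ A π) =
      linSubst σ (Polynomial ℂ) (A.map Polynomial.C) (firstOrderDeformation P π) := by
  rw [firstOrderDeformation, firstOrderDeformation, map_add, map_mul, linSubst_C, map_linSubst,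
    map_linSubst]

end BaseChange

/-! ### Linearity of the dual equation in the Hessian minor -/

section Linearity

variable {A : Type*} [CommRing A] {σ : Type*}

/-- `binCoeff` is `A`-linear: `binCoeff (c · f) = c · binCoeff f`. [cite: LandsbergManivelRessayre2013, §2.2 (p. 473)] -/
theorem binCoeff_C_mul (e : ℕ) (u v : σ → A) (c : A) (f : MvPolynomial σ A) (j : ℕ) :
    binCoeff e u v (C c * f) j = c * binCoeff e u v f j := by
  rw [binCoeff, binCoeff, binRestr, binRestr, map_mul, aeval_C, MvPolynomial.algebraMap_eq,
    coeff_C_mul]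

/-- `lmrRemainder` is linear in `q`. [cite: LandsbergManivelRessayre2013, §2.2 eq. (2) (p. 473)] -/
theorem lmrRemainder_mul_right (d e : ℕ) (p q : ℕ → A) (c : A) :
    lmrRemainder d e p (fun i => c * q i) = c * lmrRemainder d e p q := by
  rw [lmrRemainder, lmrRemainder, Finset.mul_sum]
  refine Finset.sum_congr rfl fun i _ => ?_
  ring

variable [Fintype σ]

/-- If the Hessian minor of `P` is divisible by a scalar `c`, so is every dual equation of `P`.
[cite: LandsbergManivelRessayre2013, §2.3 (p. 473)] -/
theorem lmrDualEquation_eq_mul_of_hessGenMinor_eq {κ d : ℕ} (B : Matrix (Fin (κ + 3)) σ A)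
    (u v : σ → A) (P : MvPolynomial σ A) {c : A} {G : MvPolynomial σ A}
    (hG : hessGenMinor B B P = C c * G) :
    ∃ r : A, lmrDualEquation κ d B u v P = c * r := by
  refine ⟨lmrRemainder d ((κ + 3) * (d - 2)) (binCoeff d u v P)
    (binCoeff ((κ + 3) * (d - 2)) u v G), ?_⟩
  rw [lmrDualEquation, hG, ← lmrRemainder_mul_right]
  congr 1
  funext i
  exact binCoeff_C_mul _ u v c G i

end Linearity

/-! ### The square case `k + 3 = N`: the generalised minor is `det(B)² · det Hess` -/

section Square

variable {A : Type*} [CommRing A]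

/-- For a square frame `U` (the case `k + 3 = N`), `hessGenMinor U U f = det(U)² · det(Hess f)`.
[cite: LandsbergManivelRessayre2013, §2.3 (p. 473)] -/
theorem hessGenMinor_square {n : ℕ} (U : Matrix (Fin n) (Fin n) A) (f : MvPolynomial (Fin n) A) :
    hessGenMinor U U f = C (U.det ^ 2) * (hessPoly f).det := by
  rw [hessGenMinor, det_mul, det_mul, det_transpose, ← RingHom.mapMatrix_apply, ← RingHom.map_det,
    sq, map_mul]
  ring

end Square

/-! ### The coordinate computation: `det Hess(Q(x,y) + ε z q̂(x,y)) ≡ 0 mod ε²` -/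

section Coordinate

/-- Notation-free abbreviation: the inclusion of the first two coordinates. [folklore] -/
private theorem castSucc_ne_two (j : Fin 2) : Fin.castSucc j ≠ (2 : Fin 3) := by
  intro h
  have := congrArg Fin.val h
  simp at this
  omega

/-- A form in `x, y` has no `z`-derivative. [folklore] -/
private theorem pderiv_two_rename {R : Type*} [CommRing R] (g : MvPolynomial (Fin 2) R) :
    pderiv 2 (rename Fin.castSucc g) = 0 := by
  classical
  refine pderiv_eq_zero_of_notMem_vars fun h => ?_
  obtain ⟨j, -, hj⟩ := Finset.mem_image.mp (vars_rename _ _ h)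
  exact castSucc_ne_two j hj

/-- **`det Hess(Q(x,y) + ε·z·q̂(x,y)) ≡ 0 (mod ε²)`**: the last row and column of the Hessian are
divisible by `ε` and the corner vanishes — the first-order computation behind the erratum.
[cite: LandsbergManivelRessayre2013, Proposition 4.1.1, proof (p. 482)] -/
theorem det_hessPoly_firstOrderDeformation_coordinate (Q q : MvPolynomial (Fin 2) ℂ) :
    ∃ D : MvPolynomial (Fin 3) (Polynomial ℂ),
      (hessPoly (firstOrderDeformation (rename Fin.castSucc Q)
        (X 2 * rename Fin.castSucc q))).det = C (Polynomial.X ^ 2) * D := by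
  classical
  set f := firstOrderDeformation (rename Fin.castSucc Q) (X 2 * rename Fin.castSucc q) with hf
  set r : MvPolynomial (Fin 3) (Polynomial ℂ) :=
    map (Polynomial.C : ℂ →+* Polynomial ℂ) (rename Fin.castSucc q) with hr
  have hr2 : pderiv 2 r = 0 := by
    rw [hr, pderiv_map, pderiv_two_rename, map_zero]
  -- `∂_z f = ε · r`
  have hdz : pderiv 2 f = C Polynomial.X * r := by
    rw [hf, firstOrderDeformation, map_add, pderiv_map, pderiv_two_rename, map_zero, zero_add,
      pderiv_C_mul, map_mul, map_X, pderiv_mul, pderiv_X, Pi.single_eq_same, ← hr, hr2]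
    ring
  set H := hessPoly f with hH
  have hcol : ∀ i, H i 2 = C Polynomial.X * pderiv i r := by
    intro i
    rw [hH, hessPoly_apply, hdz, pderiv_C_mul]
  have hrow : ∀ j, H 2 j = C Polynomial.X * pderiv j r := by
    intro j
    rw [hH, hessPoly_apply, pderiv_pderiv_comm, hdz, pderiv_C_mul]
  have h22 : H 2 2 = 0 := by rw [hcol, hr2, mul_zero]
  refine ⟨-(H 0 0 * pderiv 1 r * pderiv 1 r) + H 0 1 * pderiv 1 r * pderiv 0 r +
    pderiv 0 r * H 1 0 * pderiv 1 r - pderiv 0 r * H 1 1 * pderiv 0 r, ?_⟩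
  rw [det_fin_three, h22, hcol 0, hcol 1, hrow 0, hrow 1, map_pow]
  ring

end Coordinate

/-! ### (A) Transverse forms are Zariski tangent vectors at every point of `Sub₂(S³ℂ³)` -/

section Transverse

/-- `aeval` along the substituted coordinate forms is `linSubst ∘ rename`. [folklore] -/
private theorem aeval_linSubst_X_castSucc (A : Matrix (Fin 3) (Fin 3) ℂ) (g : MvPolynomial (Fin 2) ℂ) :
    aeval (fun j => linSubst (Fin 3) ℂ A (X (Fin.castSucc j))) g =
      linSubst (Fin 3) ℂ A (rename Fin.castSucc g) := by
  have h1 : aeval (fun j => linSubst (Fin 3) ℂ A (X (Fin.castSucc j))) =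
      (linSubst (Fin 3) ℂ A).comp (rename Fin.castSucc) := by
    apply MvPolynomial.algHom_ext
    intro i
    rw [aeval_X, AlgHom.comp_apply, rename_X]
  rw [h1, AlgHom.comp_apply]

/-- **(A) The excess tangent vectors.** For EVERY `3 × 3` matrix `A`, every binary `Q` and every
binary quadric `q̂`, the form `π = A·(z · q̂(x,y))` lies in the Zariski tangent space
`T̂_{P₀} 𝒟ual_{0,3,3}` at `P₀ = A·Q(x,y) ∈ Sub₂(S³ℂ³)`: over `ℂ[ε]`,
`det Hess(Q(x,y) + ε z q̂(x,y)) ≡ 0 (mod ε²)` (last row/column divisible by `ε`, corner `0`), the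
frame is square (`k + 3 = N = 3`) so `hessGenMinor` is `det(BA)² · det Hess` transported by `A`
(`hessGenMinor_linSubst`), and eq. (2) is linear in the Hessian minor — so `[ε¹] E_{B,u,v}(P₀ + επ) = 0`
for ALL `(B, u, v)`. (This is the first-order computation the printed proof of Prop. 4.1.1 skips: it
bounds the transverse part by the ORDER-`ε²` term.)
[cite: LandsbergManivelRessayre2013, Proposition 4.1.1, proof (p. 482)] -/
theorem linSubst_X_mul_rename_mem_lmrZariskiTangent (A : Matrix (Fin 3) (Fin 3) ℂ)
    (Q q : MvPolynomial (Fin 2) ℂ) (hq : q.IsHomogeneous 2) :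
    linSubst (Fin 3) ℂ A (X 2 * rename Fin.castSucc q) ∈
      lmrZariskiTangent 0 3 (linSubst (Fin 3) ℂ A (rename Fin.castSucc Q)) := by
  classical
  refine ⟨linSubst_isHomogeneous _ ((isHomogeneous_X ℂ 2).mul hq.rename_isHomogeneous),
    fun B u v => ?_⟩
  rw [firstOrderDeformation_linSubst]
  obtain ⟨D, hD⟩ := det_hessPoly_firstOrderDeformation_coordinate Q q
  have hG : hessGenMinor (B.map (Polynomial.C : ℂ →+* Polynomial ℂ))
      (B.map (Polynomial.C : ℂ →+* Polynomial ℂ))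
      (linSubst (Fin 3) (Polynomial ℂ) (A.map (Polynomial.C : ℂ →+* Polynomial ℂ))
        (firstOrderDeformation (rename Fin.castSucc Q) (X 2 * rename Fin.castSucc q))) =
      C (Polynomial.X ^ 2 *
          (B.map (Polynomial.C : ℂ →+* Polynomial ℂ) * A.map (Polynomial.C : ℂ →+* Polynomial ℂ)).det ^ 2) *
        linSubst (Fin 3) (Polynomial ℂ) (A.map (Polynomial.C : ℂ →+* Polynomial ℂ)) D := by
    rw [hessGenMinor_linSubst, hessGenMinor_square, hD, map_mul, map_mul, linSubst_C, linSubst_C,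
      map_mul]
    ring
  obtain ⟨r, hr⟩ := lmrDualEquation_eq_mul_of_hessGenMinor_eq _ _ _ _ hG
  rw [hr, mul_assoc, Polynomial.coeff_X_pow_mul', if_neg (by norm_num)]

end Transverse

/-! ### (B) … but some of them are not tangent to `Sub₂(S³ℂ³)` -/

section NonContainment

/-- The three binary quadric monomials `x², xy, y²`. [folklore] -/
private def quadMono : Fin 3 → MvPolynomial (Fin 2) ℂ := ![X 0 ^ 2, X 0 * X 1, X 1 ^ 2]

/-- Their exponents. [folklore] -/
private def quadExpo : Fin 3 → (Fin 2 →₀ ℕ) :=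
  ![Finsupp.single 0 2, Finsupp.single 0 1 + Finsupp.single 1 1, Finsupp.single 1 2]

/-- `quadMono i = monomial (quadExpo i) 1`. [folklore] -/
private theorem quadMono_eq (i : Fin 3) : quadMono i = monomial (quadExpo i) 1 := by
  fin_cases i
  · simp [quadMono, quadExpo, X_pow_eq_monomial]
  · simp only [quadMono, quadExpo, X, monomial_mul, mul_one]
    rfl
  · simp [quadMono, quadExpo, X_pow_eq_monomial]

/-- The exponents are pairwise distinct. [folklore] -/
private theorem quadExpo_injective : Function.Injective quadExpo := by
  intro i j h
  fin_cases i <;> fin_cases j <;> first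
    | rfl
    | (exfalso
       have h0 := Finsupp.ext_iff.mp h 0
       have h1 := Finsupp.ext_iff.mp h 1
       simp [quadExpo] at h0 h1)

/-- The three quadric monomials are homogeneous of degree `2`. [folklore] -/
private theorem quadMono_isHomogeneous (i : Fin 3) : (quadMono i).IsHomogeneous 2 := by
  fin_cases i
  · exact (isHomogeneous_X ℂ 0).pow 2
  · exact (isHomogeneous_X ℂ 0).mul (isHomogeneous_X ℂ 1)
  · exact (isHomogeneous_X ℂ 1).pow 2

/-- … and linearly independent. [folklore] -/
private theorem quadMono_linearIndependent : LinearIndependent ℂ quadMono := by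
  classical
  rw [Fintype.linearIndependent_iff]
  intro c hc i
  have h := congrArg (coeff (quadExpo i)) hc
  rw [coeff_sum, coeff_zero] at h
  simp only [quadMono_eq, coeff_smul, coeff_monomial, smul_eq_mul, mul_ite, mul_one, mul_zero] at h
  rw [Finset.sum_eq_single i] at h
  · simpa using h
  · intro j _ hji
    rw [if_neg]
    exact fun hij => hji (quadExpo_injective hij)
  · simp

/-- The derivative `∂_z β` of a linear form is the constant `coeff 0 (∂_z β)`. [folklore] -/
private theorem pderiv_eq_C_of_isHomogeneous_one {β : MvPolynomial (Fin 3) ℂ} (hβ : β.IsHomogeneous 1)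
    (i : Fin 3) : pderiv i β = C (coeff 0 (pderiv i β)) := by
  have h0 : (pderiv i β).IsHomogeneous 0 := by simpa using hβ.pderiv (i := i)
  exact totalDegree_eq_zero_iff_eq_C.mp ((totalDegree_zero_iff_isHomogeneous _).mpr h0)

/-- **Key implication**: if `A·(z·q̂(x,y))` is tangent to `Sub₂` at `A·Q(x,y)` (presented by the
independent forms `L_j = A·x_j`, `j < 2`), then `q̂ ∈ span{∂₀Q, ∂₁Q}` — pull back by `A⁻¹`, apply `∂_z`.
[cite: LandsbergManivelRessayre2013, Proposition 4.1.1, proof (p. 482)] -/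
theorem mem_span_pderiv_of_mem_subspaceTangent {A A' : Matrix (Fin 3) (Fin 3) ℂ} (hA : A' * A = 1)
    {Q q : MvPolynomial (Fin 2) ℂ}
    (hmem : linSubst (Fin 3) ℂ A (X 2 * rename Fin.castSucc q) ∈
      subspaceTangent 2 3 (fun j => linSubst (Fin 3) ℂ A (X (Fin.castSucc j))) Q) :
    q ∈ Submodule.span ℂ (Set.range fun a : Fin 2 => pderiv a Q) := by
  classical
  obtain ⟨Q', α, -, hα, heq⟩ := hmem
  simp only [aeval_linSubst_X_castSucc] at heq
  -- pull back by `A'`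
  have hpull : ∀ g : MvPolynomial (Fin 3) ℂ,
      linSubst (Fin 3) ℂ A' (linSubst (Fin 3) ℂ A g) = g := by
    intro g
    rw [← AlgHom.comp_apply, ← linSubst_mul, hA, linSubst_one, AlgHom.id_apply]
  have heq' := congrArg (linSubst (Fin 3) ℂ A') heq
  rw [hpull, map_add, hpull, map_sum] at heq'
  simp only [map_mul, hpull] at heq'
  -- apply `∂_z`
  have hz := congrArg (pderiv (2 : Fin 3)) heq'
  rw [(pderiv (2 : Fin 3)).leibniz, pderiv_two_rename, smul_zero, zero_add, pderiv_X, Pi.single_eq_same,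
    smul_eq_mul, mul_one, map_add, pderiv_two_rename, zero_add, map_sum] at hz
  have hterm : ∀ a : Fin 2, ∃ c : ℂ, pderiv (2 : Fin 3) (linSubst (Fin 3) ℂ A' (α a) *
      rename Fin.castSucc (pderiv a Q)) = rename Fin.castSucc (c • pderiv a Q) := by
    intro a
    obtain ⟨c, hc⟩ : ∃ c : ℂ, pderiv 2 (linSubst (Fin 3) ℂ A' (α a)) = C c :=
      ⟨_, pderiv_eq_C_of_isHomogeneous_one (linSubst_isHomogeneous _ (hα a)) 2⟩
    refine ⟨c, ?_⟩
    rw [(pderiv (2 : Fin 3)).leibniz, pderiv_two_rename, smul_zero, zero_add, smul_eq_mul, hc, map_smul,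
      smul_eq_C_mul, mul_comm]
  choose cc hcc using hterm
  simp only [hcc, ← map_sum] at hz
  have hq : q = ∑ a : Fin 2, cc a • pderiv a Q := rename_injective _ (Fin.castSucc_injective 2) hz
  rw [hq]
  exact Submodule.sum_mem _ fun a _ => Submodule.smul_mem _ _ (Submodule.subset_span ⟨a, rfl⟩)

/-- **(B) Non-containment.** For every `A` with a left inverse and every binary `Q`, one of the
three transverse forms `A·(z x²)`, `A·(z xy)`, `A·(z y²)` is NOT tangent to `Sub₂(S³ℂ³)` at `A·Q(x,y)`:
`span{∂₀Q, ∂₁Q}` has dimension `≤ 2 < 3`. [cite: LandsbergManivelRessayre2013, Proposition 4.1.1, proof (p. 482)] -/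
theorem exists_quadric_not_mem_subspaceTangent {A A' : Matrix (Fin 3) (Fin 3) ℂ} (hA : A' * A = 1)
    (Q : MvPolynomial (Fin 2) ℂ) :
    ∃ q : MvPolynomial (Fin 2) ℂ, q.IsHomogeneous 2 ∧
      linSubst (Fin 3) ℂ A (X 2 * rename Fin.castSucc q) ∉
        subspaceTangent 2 3 (fun j => linSubst (Fin 3) ℂ A (X (Fin.castSucc j))) Q := by
  classical
  by_contra hnot
  push Not at hnot
  set V : Submodule ℂ (MvPolynomial (Fin 2) ℂ) :=
    Submodule.span ℂ (Set.range fun a : Fin 2 => pderiv a Q) with hV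
  have hmemV : ∀ i : Fin 3, quadMono i ∈ V := fun i =>
    mem_span_pderiv_of_mem_subspaceTangent hA (hnot (quadMono i) (quadMono_isHomogeneous i))
  haveI : Module.Finite ℂ V := Module.Finite.span_of_finite ℂ (Set.finite_range _)
  have hle : Module.finrank ℂ V ≤ 2 := by
    have := finrank_range_le_card (R := ℂ) (fun a : Fin 2 => pderiv a Q)
    rw [Fintype.card_fin] at this
    exact this
  have hli : LinearIndependent ℂ (fun i : Fin 3 => (⟨quadMono i, hmemV i⟩ : V)) := by
    refine LinearIndependent.of_comp V.subtype ?_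
    exact quadMono_linearIndependent
  have h3 := hli.fintype_card_le_finrank
  rw [Fintype.card_fin] at h3
  omega

end NonContainment

/-! ### (C) Every point of `Sub₂(S³ℂ³)` is `A·Q(x,y)`; the refutation -/

section Refutation

/-- A permutation matrix with its inverse: `linSubst (τ⁻¹-matrix) = rename τ`. [folklore] -/
private theorem exists_perm_avoiding (S : Finset (Fin 3)) (hS : S.card ≤ 2) :
    ∃ τ : Equiv.Perm (Fin 3), ∀ s ∈ S, τ s ≠ 2 := by
  have hne : S ≠ Finset.univ := by
    intro h
    rw [h, Finset.card_univ, Fintype.card_fin] at hS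
    omega
  obtain ⟨i, -, hi⟩ := Finset.exists_of_ssubset (Finset.ssubset_univ_iff.mpr hne)
  refine ⟨Equiv.swap i 2, fun s hs h => ?_⟩
  have : s = i := by
    have h' := congrArg (Equiv.swap i 2) h
    rw [Equiv.swap_apply_self, Equiv.swap_apply_right] at h'
    exact h'
  exact hi (this ▸ hs)

/-- **Every point of `Sub₂(S³ ℂ³)` is `A · Q(x,y)`** with `A ∈ GL₃` (two-sided inverse `A'`) and `Q` a
binary cubic (a permutation moves the `≤ 2` surviving variables onto `x, y`).
[cite: LandsbergManivelRessayre2013, §4 (p. 481)] -/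
theorem exists_linSubst_rename_of_mem_subspaceVariety {P : MvPolynomial (Fin 3) ℂ}
    (hP : P ∈ subspaceVariety (Fin 3) ℂ 2 3) :
    ∃ (A A' : Matrix (Fin 3) (Fin 3) ℂ) (Q : MvPolynomial (Fin 2) ℂ),
      A' * A = 1 ∧ A * A' = 1 ∧ Q.IsHomogeneous 3 ∧
        P = linSubst (Fin 3) ℂ A (rename Fin.castSucc Q) := by
  classical
  obtain ⟨hhom, g, S, hS, hvars⟩ := hP
  obtain ⟨τ, hτ⟩ := exists_perm_avoiding S hS
  -- the permutation matrices
  set Pτ : Matrix (Fin 3) (Fin 3) ℂ := (τ⁻¹).permMatrix ℂ with hPτ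
  set Pτ' : Matrix (Fin 3) (Fin 3) ℂ := τ.permMatrix ℂ with hPτ'
  have hren : linSubst (Fin 3) ℂ Pτ = rename τ := by
    rw [hPτ, linSubst_permMatrix]
    rfl
  have h1 : Pτ' * Pτ = 1 := by
    rw [hPτ, hPτ', ← Matrix.permMatrix_mul, inv_mul_cancel, Matrix.permMatrix_one]
  have h2 : Pτ * Pτ' = 1 := by
    rw [hPτ, hPτ', ← Matrix.permMatrix_mul, mul_inv_cancel, Matrix.permMatrix_one]
  -- the substituted-and-renamed polynomial has variables among `x, y`
  set R : MvPolynomial (Fin 3) ℂ := rename τ (linSubst (Fin 3) ℂ (g : Matrix (Fin 3) (Fin 3) ℂ) P)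
    with hR
  have hRvars : ↑R.vars ⊆ Set.range (Fin.castSucc : Fin 2 → Fin 3) := by
    intro i hi
    have hi' := vars_rename τ _ (Finset.mem_coe.mp hi)
    obtain ⟨s, hs, rfl⟩ := Finset.mem_image.mp hi'
    have hs' : s ∈ S := by
      have := hvars (Finset.mem_coe.mpr (by simpa [linSubstRep_apply] using hs))
      simpa using this
    obtain ⟨j, hj⟩ := Fin.exists_castSucc_eq.mpr (hτ s hs')
    exact ⟨j, hj⟩
  obtain ⟨Q, hQ⟩ := exists_rename_eq_of_vars_subset_range R Fin.castSucc (Fin.castSucc_injective 2) hRvars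
  have hRhom : R.IsHomogeneous 3 := (linSubst_isHomogeneous _ hhom).rename_isHomogeneous
  have hQhom : Q.IsHomogeneous 3 := by
    rw [← hQ] at hRhom
    exact (IsHomogeneous.rename_isHomogeneous_iff (Fin.castSucc_injective 2)).mp hRhom
  have hA'A : Pτ * (g : Matrix (Fin 3) (Fin 3) ℂ) * ((↑g⁻¹ : Matrix (Fin 3) (Fin 3) ℂ) * Pτ') = 1 := by
    rw [Matrix.mul_assoc, ← Matrix.mul_assoc (g : Matrix (Fin 3) (Fin 3) ℂ), ← Units.val_mul,
      mul_inv_cancel, Units.val_one, Matrix.one_mul, h2]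
  have hAA' : (↑g⁻¹ : Matrix (Fin 3) (Fin 3) ℂ) * Pτ' * (Pτ * (g : Matrix (Fin 3) (Fin 3) ℂ)) = 1 := by
    rw [Matrix.mul_assoc, ← Matrix.mul_assoc Pτ', h1, Matrix.one_mul, ← Units.val_mul, inv_mul_cancel,
      Units.val_one]
  refine ⟨(↑g⁻¹ : Matrix (Fin 3) (Fin 3) ℂ) * Pτ', Pτ * (g : Matrix (Fin 3) (Fin 3) ℂ), Q, hA'A, hAA',
    hQhom, ?_⟩
  rw [hQ, hR, ← hren, ← AlgHom.comp_apply, ← linSubst_mul, ← AlgHom.comp_apply, ← linSubst_mul,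
    show (↑g⁻¹ : Matrix (Fin 3) (Fin 3) ℂ) * Pτ' * Pτ * (g : Matrix (Fin 3) (Fin 3) ℂ) =
      (↑g⁻¹ : Matrix (Fin 3) (Fin 3) ℂ) * Pτ' * (Pτ * (g : Matrix (Fin 3) (Fin 3) ℂ)) from Matrix.mul_assoc _ _ _,
    hAA', linSubst_one, AlgHom.id_apply]

/-- The substituted coordinate forms `A·x_j` (`j < 2`) are linearly independent for `A` with a left
inverse. [folklore] -/
private theorem linearIndependent_linSubst_X {A A' : Matrix (Fin 3) (Fin 3) ℂ} (hA : A' * A = 1) :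
    LinearIndependent ℂ (fun j : Fin 2 => linSubst (Fin 3) ℂ A (X (Fin.castSucc j))) := by
  classical
  rw [Fintype.linearIndependent_iff]
  intro c hc i
  have h1 : linSubst (Fin 3) ℂ A (∑ j, c j • X (Fin.castSucc j)) = 0 := by
    rw [map_sum]
    simpa only [map_smul] using hc
  have h2 : (∑ j, c j • X (Fin.castSucc j) : MvPolynomial (Fin 3) ℂ) = 0 := by
    have := congrArg (linSubst (Fin 3) ℂ A') h1
    rwa [← AlgHom.comp_apply, ← linSubst_mul, hA, linSubst_one, AlgHom.id_apply, map_zero] at this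
  have h3 := congrArg (coeff (Finsupp.single (Fin.castSucc i) 1)) h2
  rw [coeff_sum, coeff_zero] at h3
  simp only [coeff_smul, coeff_X, smul_eq_mul, mul_ite, mul_one, mul_zero] at h3
  rw [Finset.sum_eq_single i] at h3
  · simpa using h3
  · intro j _ hji
    rw [if_neg]
    intro h
    exact hji (Fin.castSucc_injective 2 (Finsupp.single_left_injective one_ne_zero h))
  · simp

/-- **LMR 2013, Prop. 4.1.1 (journal) = arXiv Prop. 4.0.3, AS TYPED, IS FALSE** — refuted through its
second conjunct («`Sub_{k+2}(S^d W^*)` is a REDUCED component of `𝒟ual_{k,d,N}`», rendered as the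
tangent-space inclusion `T̂_P 𝒟ual ⊆ T̂_P Sub` at a general point `P ∈ Sub`) at `(k, d, N) = (0, 3, 3)`:
for EVERY binary cubic `Q`, every `A ∈ GL₃` and hence at EVERY point `P = A·Q(x,y)` of `Sub₂(S³ℂ³)`
(so at every `g`-general one), the transverse forms `A·(z q̂(x,y))` are Zariski tangent to the scheme
cut out by eqs. (2) (part (A)) while one of them is not tangent to `Sub₂` (part (B)). The first
conjunct (component) is refuted independently at `k = 0` by the route `Sub₂(S³ℂ³) ⊊ Δ(xyz) ⊆ 𝒟_{0,3,3}`
(lead-lmr g3, 2026-08-26). ERRATUM CANDIDATE for the print (the proof, arXiv p0010:L52–L81, controls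
2-jets, not the Zariski tangent space). The typed text `LMR2013_prop_4_1_1` is FAITHFUL to the print;
its PROVED parts are `subspaceVariety_subset_lmrDualScheme` (⊆), closedness and
`subspaceVariety_isCoeffZariskiIrreducible`. [cite: LandsbergManivelRessayre2013, Proposition 4.1.1 (p. 482)] -/
theorem not_LMR2013_prop_4_1_1 : ¬ LMR2013_prop_4_1_1 (σ := Fin 3) := by
  classical
  intro H
  obtain ⟨-, g, ⟨P, hP, hgP⟩, hall⟩ := H 0 3 le_rfl (by simp)
  obtain ⟨A, A', Q, hA'A, -, hQ, hPeq⟩ := exists_linSubst_rename_of_mem_subspaceVariety hP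
  have hL1 : ∀ a : Fin 2, (linSubst (Fin 3) ℂ A (X (Fin.castSucc a))).IsHomogeneous 1 :=
    fun a => linSubst_isHomogeneous _ (isHomogeneous_X ℂ _)
  have haevalQ : aeval (fun j => linSubst (Fin 3) ℂ A (X (Fin.castSucc j))) Q = P := by
    rw [aeval_linSubst_X_castSucc, hPeq]
  have hcont := hall (fun j => linSubst (Fin 3) ℂ A (X (Fin.castSucc j))) Q hL1
    (linearIndependent_linSubst_X hA'A) hQ (by rw [haevalQ]; exact hgP)
  obtain ⟨q, hq2, hnot⟩ := exists_quadric_not_mem_subspaceTangent hA'A Q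
  refine hnot (hcont ?_)
  rw [haevalQ, hPeq]
  exact linSubst_X_mul_rename_mem_lmrZariskiTangent A Q q hq2

end Refutation

end Literature.Computability.AlgebraicComplexity
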